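import Summits.ABC.ABC.Theorems.IsogenyGlueCongruenceDegreePrimesPolyBoundedNewPartRealization
import Summits.ABC.ABC.Theorems.IsogenyGlueCongruencePolyFreyMazurPairsStubSturmTwoLevel
import HarnessLib

/-!
# Crux A `DegreePrimesPolyBounded` (stmt-ABC-2045), line `newpart-congruence-friability` —
# a separating Hecke element of small height between two Galois orbits

Registered sub-goal `stub_separatingHeckeElement` (second lead, unit `line-stmt-ABC-2045-c1`), the
first half of the E-free calibration of the bet `stub_gradedNewPartFriability`: for two distinct
minimal primes `P ≠ Q` of `𝕋 = anemicHeckeRing N 2` (two Galois orbits of eigen-systems of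
`S₂(Γ₀(N))`) there is `t = Σ_{p < B, p ∤ N} c_p T_p` (`0 ≤ c_p ≤ d_P d_Q`, `B` the Sturm window
of level `N rad N`) on which NO complex point of `Spec 𝕋/P` agrees with a complex point of
`Spec 𝕋/Q`, with `|ρ(t)| ≤ 8 d_P d_Q N⁶` at every complex point `ρ` of `Spec 𝕋`
(`exists_separating_heckeElement`).  Ingredients: every complex point of `Spec 𝕋` is the system
of an Atkin–Lehner eigenform (`exists_isNewform0_apply_eq_smul_of_ringHom`, the realization
theorem of the sibling file), two such systems agreeing at all `T_p`, `p < B`, coincide (two-level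
Sturm, `coeff_eq_of_coprime_of_forall_prime_lt_sturm_twoLevel`), and `≤ K` nonzero linear forms
have a common non-zero on the grid `{0,…,K}^m` (`exists_grid_forall_sum_ne_zero`).

## References

* [PastenShimura2024] H. Pasten, *Shimura curves and the abc conjecture*, J. Number Theory 254
  (2024) 214–335, §4.9–4.11 p. 16, proof of Thm. 7.2 p. 26.
* [Sturm1987] J. Sturm, *On the congruence of modular forms*, LNM 1240 (1987), Thm. 1.
-/

noncomputable section

open scoped MatrixGroups ModularForm
open CongruenceSubgroup UpperHalfPlane Polynomial

-- `Summit.<Summit>.<Problem>` is the mandated summit-side namespace (CONVENTIONS §2); for the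
-- single-conjunct summit `ABC` the two coincide, so the duplicate `ABC.ABC` is deliberate.
set_option linter.dupNamespace false

namespace Summit.ABC.ABC.Theorems.DegreePrimesPolyBounded

open Literature.NumberTheory.EllipticCurves.ModularForms

/-! ### Combinatorics: avoiding finitely many nonzero linear forms on a small grid -/

/-- **Grid avoidance.** At most `K` nonzero linear forms on `ℂ^ι` (`ι` finite) have a common
non-zero in the grid `{0, …, K}^ι`: a nonzero form vanishes on at most `(K+1)^{#ι - 1}` grid
points (one coordinate is determined by the others), and `K (K+1)^{#ι-1} < (K+1)^{#ι}`.
[folklore] -/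
theorem exists_grid_forall_sum_ne_zero {ι : Type*} [Fintype ι] [DecidableEq ι] {J : Type*}
    (s : Finset J) (δ : J → ι → ℂ) (hδ : ∀ j ∈ s, δ j ≠ 0) (K : ℕ) (hK : s.card ≤ K) :
    ∃ c : ι → ℕ, (∀ i, c i ≤ K) ∧ ∀ j ∈ s, ∑ i, (c i : ℂ) * δ j i ≠ 0 := by
  classical
  let G : Finset (ι → ℕ) := Fintype.piFinset fun _ ↦ Finset.range (K + 1)
  have hGcard : G.card = (K + 1) ^ Fintype.card ι := by
    rw [Fintype.card_piFinset, Finset.prod_const, Finset.card_range, Finset.card_univ]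
  have hbad : ∀ j ∈ s, ((G.filter fun c ↦ ∑ i, (c i : ℂ) * δ j i = 0).card) * (K + 1) ≤
      G.card := by
    intro j hj
    obtain ⟨i₀, hi₀⟩ : ∃ i₀, δ j i₀ ≠ 0 := by
      by_contra h
      push Not at h
      exact hδ j hj (funext h)
    let G₀ : Finset (ι → ℕ) :=
      Fintype.piFinset fun i ↦ if i = i₀ then {0} else Finset.range (K + 1)
    have hG₀card : G₀.card * (K + 1) = G.card := by
      rw [Fintype.card_piFinset, Fintype.card_piFinset,
        ← Finset.prod_erase_mul (s := Finset.univ) _ (Finset.mem_univ i₀), if_pos rfl,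
        Finset.card_singleton, mul_one,
        ← Finset.prod_erase_mul (s := Finset.univ) _ (Finset.mem_univ i₀), Finset.card_range]
      congr 1
      exact Finset.prod_congr rfl fun i hi ↦ by
        rw [if_neg (Finset.ne_of_mem_erase hi), Finset.card_range]
    rw [← hG₀card]
    refine Nat.mul_le_mul_right _ (Finset.card_le_card_of_injOn (fun c ↦ Function.update c i₀ 0)
      (fun c hc ↦ ?_) (fun c hc c' hc' h ↦ ?_))
    · have hcG := (Finset.mem_filter.mp hc).1
      rw [Finset.mem_coe, Fintype.mem_piFinset]
      intro i
      by_cases hi : i = i₀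
      · subst hi; simp
      · simp only [if_neg hi, Function.update_of_ne hi]
        exact Fintype.mem_piFinset.mp hcG i
    · have hc0 := (Finset.mem_filter.mp hc).2
      have hc'0 := (Finset.mem_filter.mp hc').2
      have hoff : ∀ i, i ≠ i₀ → c i = c' i := fun i hi ↦ by
        have := congrFun h i
        simpa only [Function.update_of_ne hi] using this
      funext i
      by_cases hi : i = i₀
      · subst hi
        have hsplit : ∀ e : ι → ℕ, ∑ i', (e i' : ℂ) * δ j i' =
            (e i : ℂ) * δ j i + ∑ i' ∈ Finset.univ.erase i, (e i' : ℂ) * δ j i' := fun e ↦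
          (Finset.add_sum_erase _ _ (Finset.mem_univ i)).symm
        rw [hsplit] at hc0 hc'0
        have hrest : ∑ i' ∈ Finset.univ.erase i, (c i' : ℂ) * δ j i' =
            ∑ i' ∈ Finset.univ.erase i, (c' i' : ℂ) * δ j i' :=
          Finset.sum_congr rfl fun i' hi' ↦ by rw [hoff i' (Finset.ne_of_mem_erase hi')]
        rw [hrest] at hc0
        have := hc0.trans hc'0.symm
        rw [add_left_inj] at this
        exact_mod_cast mul_right_cancel₀ hi₀ this
      · exact hoff i hi
  by_cases hs : s = ∅
  · exact ⟨fun _ ↦ 0, fun _ ↦ Nat.zero_le _, by simp [hs]⟩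
  have hne : Nonempty ι := by
    obtain ⟨j, hj⟩ := Finset.nonempty_iff_ne_empty.mpr hs
    by_contra h
    rw [not_nonempty_iff] at h
    exact hδ j hj (funext fun i ↦ (IsEmpty.false i).elim)
  let Bad : Finset (ι → ℕ) := s.biUnion fun j ↦ G.filter fun c ↦ ∑ i, (c i : ℂ) * δ j i = 0
  have hBad : Bad.card * (K + 1) ≤ s.card * G.card := by
    calc Bad.card * (K + 1)
        ≤ (∑ j ∈ s, (G.filter fun c ↦ ∑ i, (c i : ℂ) * δ j i = 0).card) * (K + 1) :=
          Nat.mul_le_mul_right _ Finset.card_biUnion_le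
      _ = ∑ j ∈ s, (G.filter fun c ↦ ∑ i, (c i : ℂ) * δ j i = 0).card * (K + 1) :=
          Finset.sum_mul _ _ _
      _ ≤ ∑ j ∈ s, G.card := Finset.sum_le_sum hbad
      _ = s.card * G.card := by rw [Finset.sum_const, smul_eq_mul]
  have hlt : Bad.card < G.card := by
    have hGpos : 0 < G.card := by rw [hGcard]; positivity
    have h1 : s.card * G.card < (K + 1) * G.card := Nat.mul_lt_mul_of_pos_right (by omega) hGpos
    have := lt_of_le_of_lt hBad h1
    rw [mul_comm (K + 1)] at this
    exact Nat.lt_of_mul_lt_mul_right this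
  obtain ⟨c, hcG, hcBad⟩ := Finset.exists_mem_notMem_of_card_lt_card hlt
  refine ⟨c, fun i ↦ ?_, fun j hj hsum ↦ hcBad ?_⟩
  · have := Fintype.mem_piFinset.mp hcG i
    rw [Finset.mem_range] at this
    omega
  · exact Finset.mem_biUnion.mpr ⟨j, hj, Finset.mem_filter.mpr ⟨hcG, hsum⟩⟩

/-! ### Hecke-ring bookkeeping -/

variable {N : ℕ} [NeZero N] {k : ℤ}

/-- Two ring maps `𝕋 → ℂ` agreeing on the generators `T_p`, `p ∤ N`, are equal. [folklore] -/
theorem ringHom_ext_of_forall_T {ψ ψ' : anemicHeckeRing N k →+* ℂ}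
    (h : ∀ (p : ℕ) (hp : p.Prime) (hpN : ¬ p ∣ N),
      ψ (@anemicHeckeRing.T N _ k p ⟨hp.ne_zero⟩ hp hpN) =
        ψ' (@anemicHeckeRing.T N _ k p ⟨hp.ne_zero⟩ hp hpN)) : ψ = ψ' := by
  refine RingHom.ext fun t ↦ ?_
  obtain ⟨t, ht⟩ := t
  induction ht using Algebra.adjoin_induction with
  | mem x hx =>
    obtain ⟨p, hp, hpN, rfl⟩ := hx
    exact h p hp hpN
  | algebraMap r =>
    have hx : (⟨algebraMap ℤ _ r, Subalgebra.algebraMap_mem _ r⟩ : anemicHeckeRing N k) =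
        (r : anemicHeckeRing N k) :=
      Subtype.ext (by rw [SubringClass.coe_intCast]; exact eq_intCast (algebraMap ℤ _) r)
    calc ψ ⟨algebraMap ℤ _ r, Subalgebra.algebraMap_mem _ r⟩ = ψ (r : anemicHeckeRing N k) :=
          congrArg ψ hx
      _ = ψ' (r : anemicHeckeRing N k) := by rw [map_intCast, map_intCast]
      _ = ψ' ⟨algebraMap ℤ _ r, Subalgebra.algebraMap_mem _ r⟩ := (congrArg ψ' hx).symm
  | add x y hx hy hx' hy' =>
    have : (⟨x + y, add_mem hx hy⟩ : anemicHeckeRing N k) = ⟨x, hx⟩ + ⟨y, hy⟩ := rfl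
    rw [this, map_add, map_add, hx', hy']
  | mul x y hx hy hx' hy' =>
    have : (⟨x * y, mul_mem hx hy⟩ : anemicHeckeRing N k) = ⟨x, hx⟩ * ⟨y, hy⟩ := rfl
    rw [this, map_mul, map_mul, hx', hy']

/-- The set of complex points of `Spec 𝕋` with kernel a given minimal prime `P` is finite, with
at most `rank_ℤ(𝕋 ⧸ P)` members. [folklore] -/
theorem finite_setOf_ker_eq {P : Ideal (anemicHeckeRing N k)}
    (hP : P ∈ minimalPrimes (anemicHeckeRing N k)) :
    {ψ : anemicHeckeRing N k →+* ℂ | RingHom.ker ψ = P}.Finite ∧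
      ∀ F : Finset (anemicHeckeRing N k →+* ℂ), (∀ ψ ∈ F, RingHom.ker ψ = P) →
        F.card ≤ Module.finrank ℤ (anemicHeckeRing N k ⧸ P) := by
  haveI := free_quotient_of_mem_minimalPrimes hP
  haveI := finite_quotient_anemicHeckeRing P
  have hF : ∀ F : Finset (anemicHeckeRing N k →+* ℂ), (∀ ψ ∈ F, RingHom.ker ψ = P) →
      F.card ≤ Module.finrank ℤ (anemicHeckeRing N k ⧸ P) :=
    fun F h ↦ card_ringHom_ker_eq_le_finrank P F h
  refine ⟨?_, hF⟩
  by_contra hinf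
  obtain ⟨F, hFsub, hFcard⟩ := Set.Infinite.exists_subset_card_eq hinf
    (Module.finrank ℤ (anemicHeckeRing N k ⧸ P) + 1)
  have := hF F fun ψ hψ ↦ hFsub (Finset.mem_coe.mpr hψ)
  omega

/-! ### The separating Hecke element -/

/-- **A separating Hecke element of small height (weight `2`).** For distinct minimal primes
`P ≠ Q` of `𝕋 = anemicHeckeRing N 2` there is `t ∈ 𝕋` with `ψ(t) ≠ ψ'(t)` for every pair of
complex points `ψ` of `Spec 𝕋/P` and `ψ'` of `Spec 𝕋/Q`, and `|ρ(t)| ≤ 8 d_P d_Q N⁶` at every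
complex point `ρ` of `Spec 𝕋` (`d = rank_ℤ 𝕋/·`): `t = Σ_{p < B, p ∤ N} c_p T_p` with
`0 ≤ c_p ≤ d_P d_Q`, `B` the Sturm window of level `N rad N` (`≤ N³ + 1`).  Two complex points
agreeing at all these `T_p` are systems of Atkin–Lehner eigenforms with the same `a_p`, `p < B`,
hence the same system (two-level Sturm), so `P = Q`; the `≤ d_P d_Q` pairs are then separated
by grid avoidance. [cite: PastenShimura2024, proof of Thm. 7.2, p. 26] -/
theorem exists_separating_heckeElement {P Q : Ideal (anemicHeckeRing N 2)}
    (hP : P ∈ minimalPrimes (anemicHeckeRing N 2)) (hQ : Q ∈ minimalPrimes (anemicHeckeRing N 2))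
    (hPQ : P ≠ Q) :
    ∃ t : anemicHeckeRing N 2,
      (∀ ρ : anemicHeckeRing N 2 →+* ℂ, ‖ρ t‖ ≤
        8 * (Module.finrank ℤ (anemicHeckeRing N 2 ⧸ P) * Module.finrank ℤ (anemicHeckeRing N 2 ⧸ Q) : ℕ)
          * (N : ℝ) ^ 6) ∧
      ∀ ψ ψ' : anemicHeckeRing N 2 →+* ℂ, RingHom.ker ψ = P → RingHom.ker ψ' = Q → ψ t ≠ ψ' t := by
  classical
  set dP := Module.finrank ℤ (anemicHeckeRing N 2 ⧸ P) with hdP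
  set dQ := Module.finrank ℤ (anemicHeckeRing N 2 ⧸ Q) with hdQ
  set K := dP * dQ with hK
  -- the Sturm window and the small primes off the level
  set B : ℕ := ((2 : ℤ) * gamma0Index (N * ∏ q ∈ N.primeFactors, q)).toNat / 12 + 1 with hB
  have hBN : B ≤ N ^ 3 + 1 := by
    have := Summit.ABC.ABC.Theorems.PolyFreyMazurPairs.sturmWindow_two_le (NeZero.ne N)
    omega
  set prs : Finset ℕ := (Finset.range B).filter fun p ↦ p.Prime ∧ ¬ p ∣ N with hprs
  have hprs_spec : ∀ p ∈ prs, p.Prime ∧ ¬ p ∣ N ∧ p < B := fun p hp ↦ by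
    obtain ⟨h1, h2, h3⟩ := Finset.mem_filter.mp hp
    exact ⟨h2, h3, Finset.mem_range.mp h1⟩
  let Tg : prs → anemicHeckeRing N 2 := fun p ↦
    @anemicHeckeRing.T N _ 2 p.1 ⟨(hprs_spec p.1 p.2).1.ne_zero⟩ (hprs_spec p.1 p.2).1
      (hprs_spec p.1 p.2).2.1
  -- the finitely many pairs of complex points
  obtain ⟨hPfin, hPcard⟩ := finite_setOf_ker_eq hP
  obtain ⟨hQfin, hQcard⟩ := finite_setOf_ker_eq hQ
  set prsSet := hPfin.toFinset ×ˢ hQfin.toFinset with hprsSet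
  have hcardK : prsSet.card ≤ K := by
    rw [hprsSet, Finset.card_product, hK]
    exact Nat.mul_le_mul (hPcard _ fun ψ hψ ↦ hPfin.mem_toFinset.mp hψ)
      (hQcard _ fun ψ hψ ↦ hQfin.mem_toFinset.mp hψ)
  -- the linear conditions are nonzero: two-level Sturm
  let δ : ((anemicHeckeRing N 2 →+* ℂ) × (anemicHeckeRing N 2 →+* ℂ)) → prs → ℂ :=
    fun π p ↦ π.1 (Tg p) - π.2 (Tg p)
  have hδ : ∀ π ∈ prsSet, δ π ≠ 0 := by
    intro π hπ hzero
    obtain ⟨hπ1, hπ2⟩ := Finset.mem_product.mp hπ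
    have hk1 : RingHom.ker π.1 = P := hPfin.mem_toFinset.mp hπ1
    have hk2 : RingHom.ker π.2 = Q := hQfin.mem_toFinset.mp hπ2
    -- realize both points by Atkin–Lehner eigenforms
    obtain ⟨x, g, hg, -, -, hTg⟩ := exists_isNewform0_apply_eq_smul_of_ringHom π.1
    obtain ⟨x', g', hg', -, -, hTg'⟩ := exists_isNewform0_apply_eq_smul_of_ringHom π.2
    haveI : NeZero x.1.1 := ⟨fun h ↦ NeZero.ne N (Nat.eq_zero_of_zero_dvd (h ▸ (dvd_mul_right _ _).trans x.2))⟩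
    haveI : NeZero x'.1.1 := ⟨fun h ↦ NeZero.ne N (Nat.eq_zero_of_zero_dvd (h ▸ (dvd_mul_right _ _).trans x'.2))⟩
    -- `a_p(g) = a_p(g')` below the Sturm window
    have hsmall : ∀ p : ℕ, p.Prime → ¬ p ∣ N → p < B →
        (qExpansion 1 ⇑g).coeff p = (qExpansion 1 ⇑g').coeff p := by
      intro p hp hpN hpB
      have hmem : p ∈ prs := Finset.mem_filter.mpr ⟨Finset.mem_range.mpr hpB, hp, hpN⟩
      have h0 := congrFun hzero ⟨p, hmem⟩
      simp only [δ, Pi.zero_apply, sub_eq_zero] at h0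
      rw [← hTg p hp hpN, ← hTg' p hp hpN]
      exact h0
    -- hence everywhere prime to `N` (two-level Sturm at `L = N`)
    have hall : ∀ n : ℕ, n.Coprime N → (qExpansion 1 ⇑g).coeff n = (qExpansion 1 ⇑g').coeff n :=
      fun n hn ↦ Summit.ABC.ABC.Theorems.PolyFreyMazurPairs.coeff_eq_of_coprime_of_forall_prime_lt_sturm_twoLevel
        hg hg' ((dvd_mul_right _ _).trans x.2) ((dvd_mul_right _ _).trans x'.2) hsmall hn
    -- hence the two points coincide, and so do their kernels
    have heq : π.1 = π.2 := ringHom_ext_of_forall_T fun p hp hpN ↦ by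
      rw [hTg p hp hpN, hTg' p hp hpN]
      exact hall p ((Nat.Prime.coprime_iff_not_dvd hp).mpr hpN)
    exact hPQ (hk1.symm.trans (heq ▸ hk2))
  -- grid avoidance
  obtain ⟨c, hcK, hc⟩ := exists_grid_forall_sum_ne_zero prsSet δ hδ K hcardK
  refine ⟨∑ p : prs, (c p : anemicHeckeRing N 2) * Tg p, fun ρ ↦ ?_, fun ψ ψ' hψ hψ' heq ↦ ?_⟩
  · -- height bound: `|ρ(t)| ≤ Σ c_p · 2p ≤ #prs · K · 2B ≤ 8 K N⁶`
    rw [map_sum]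
    have hterm : ∀ p : prs, ‖ρ ((c p : anemicHeckeRing N 2) * Tg p)‖ ≤ K * (2 * B) := by
      intro p
      rw [map_mul, map_natCast, norm_mul, Complex.norm_natCast]
      have h1 : ‖ρ (Tg p)‖ ≤ 2 * (p.1 : ℝ) :=
        norm_ringHom_T_le_two_mul ρ p.1 (hprs_spec p.1 p.2).1 (hprs_spec p.1 p.2).2.1
      have h2 : (p.1 : ℝ) ≤ B := by exact_mod_cast (hprs_spec p.1 p.2).2.2.le
      have h3 : (c p : ℝ) ≤ K := by exact_mod_cast hcK p
      have h4 : (0 : ℝ) ≤ ‖ρ (Tg p)‖ := norm_nonneg _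
      exact mul_le_mul h3 (h1.trans (by linarith)) h4 (Nat.cast_nonneg _)
    have hcard : (Fintype.card prs : ℝ) ≤ B := by
      have : prs.card ≤ B := (Finset.card_filter_le _ _).trans (Finset.card_range B).le
      rw [Fintype.card_coe]
      exact_mod_cast this
    have hB' : (B : ℝ) ≤ 2 * (N : ℝ) ^ 3 := by
      have h1 : (B : ℝ) ≤ (N : ℝ) ^ 3 + 1 := by exact_mod_cast hBN
      have h2 : (1 : ℝ) ≤ (N : ℝ) ^ 3 :=
        one_le_pow₀ (by exact_mod_cast NeZero.one_le)
      linarith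
    have hK0 : (0 : ℝ) ≤ K := Nat.cast_nonneg _
    have hB0 : (0 : ℝ) ≤ B := Nat.cast_nonneg _
    calc ‖∑ p : prs, ρ ((c p : anemicHeckeRing N 2) * Tg p)‖
        ≤ ∑ p : prs, ‖ρ ((c p : anemicHeckeRing N 2) * Tg p)‖ := norm_sum_le _ _
      _ ≤ ∑ _p : prs, (K : ℝ) * (2 * B) := Finset.sum_le_sum fun p _ ↦ hterm p
      _ = (Fintype.card prs : ℝ) * (K * (2 * B)) := by
          rw [Finset.sum_const, Finset.card_univ, nsmul_eq_mul]
      _ ≤ B * (K * (2 * B)) := by gcongr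
      _ = 2 * K * B ^ 2 := by ring
      _ ≤ 2 * K * (2 * (N : ℝ) ^ 3) ^ 2 := by gcongr
      _ = 8 * (K : ℝ) * (N : ℝ) ^ 6 := by ring
      _ = 8 * ((dP * dQ : ℕ) : ℝ) * (N : ℝ) ^ 6 := by rw [hK]
  · -- separation
    have hmem : (ψ, ψ') ∈ prsSet :=
      Finset.mem_product.mpr ⟨hPfin.mem_toFinset.mpr hψ, hQfin.mem_toFinset.mpr hψ'⟩
    apply hc (ψ, ψ') hmem
    have h1 : ψ (∑ p : prs, (c p : anemicHeckeRing N 2) * Tg p) =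
        ∑ p : prs, (c p : ℂ) * ψ (Tg p) := by
      rw [map_sum]
      exact Finset.sum_congr rfl fun p _ ↦ by rw [map_mul, map_natCast]
    have h2 : ψ' (∑ p : prs, (c p : anemicHeckeRing N 2) * Tg p) =
        ∑ p : prs, (c p : ℂ) * ψ' (Tg p) := by
      rw [map_sum]
      exact Finset.sum_congr rfl fun p _ ↦ by rw [map_mul, map_natCast]
    rw [h1, h2, ← sub_eq_zero, ← Finset.sum_sub_distrib] at heq
    rw [← heq]
    exact Finset.sum_congr rfl fun p _ ↦ by simp only [δ]; ring

/-- **Registered sub-goal `stub_separatingHeckeElement` (line `newpart-congruence-friability`,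
crux stmt-ABC-2045)**: `exists_separating_heckeElement` at every level. [cite: PastenShimura2024, proof of Thm. 7.2, p. 26] -/
theorem stub_separatingHeckeElement :
    ∀ (N : ℕ) [NeZero N] (P Q : Ideal (anemicHeckeRing N 2)),
      P ∈ minimalPrimes (anemicHeckeRing N 2) → Q ∈ minimalPrimes (anemicHeckeRing N 2) → P ≠ Q →
      ∃ t : anemicHeckeRing N 2,
        (∀ ρ : anemicHeckeRing N 2 →+* ℂ, ‖ρ t‖ ≤
          8 * (Module.finrank ℤ (anemicHeckeRing N 2 ⧸ P) *
            Module.finrank ℤ (anemicHeckeRing N 2 ⧸ Q) : ℕ) * (N : ℝ) ^ 6) ∧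
        ∀ ψ ψ' : anemicHeckeRing N 2 →+* ℂ, RingHom.ker ψ = P → RingHom.ker ψ' = Q →
          ψ t ≠ ψ' t :=
  fun _ _ _ _ hP hQ hPQ ↦ exists_separating_heckeElement hP hQ hPQ

end Summit.ABC.ABC.Theorems.DegreePrimesPolyBounded

end
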